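import Literature.MathematicalPhysics.QuantumFieldTheory.Balaban1983to89.B6Prop26KLevelAssemblyV1L0
import Literature.MathematicalPhysics.QuantumFieldTheory.Balaban1983to89.B6Ineq2134TKFamKLevelExportV1
import Literature.MathematicalPhysics.QuantumFieldTheory.Balaban1983to89.B6Ineq2134TransposeKLevelTorusL0
import Literature.MathematicalPhysics.QuantumFieldTheory.Balaban1983to89.B6Ineq2134TransposeDiag
import Literature.MathematicalPhysics.QuantumFieldTheory.Balaban1983to89.B6OpTransposeV1L0
import Literature.MathematicalPhysics.QuantumFieldTheory.Balaban1983to89.B6CubeRightLegsV1L0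
import Literature.MathematicalPhysics.QuantumFieldTheory.Balaban1983to89.B6Line3CubeTransposeV1L0
import Literature.MathematicalPhysics.QuantumFieldTheory.Balaban1983to89.B6Cover236MultiLevelBlocksL0
import Literature.MathematicalPhysics.QuantumFieldTheory.Balaban1983to89.B6CubeCoeffSizesV1L0
import Literature.MathematicalPhysics.QuantumFieldTheory.Balaban1983to89.B6CubeInDecayV1L0
import Literature.MathematicalPhysics.QuantumFieldTheory.Balaban1983to89.B6CubeWindowV1L0
import Literature.MathematicalPhysics.QuantumFieldTheory.Balaban1983to89.B6Dg288ChartV1L0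
import Literature.MathematicalPhysics.QuantumFieldTheory.Balaban1983to89.B6Eq292MemberTorusV1L0
import Literature.MathematicalPhysics.QuantumFieldTheory.Balaban1983to89.B6Geom246MultiLevelBoxL0
import Literature.MathematicalPhysics.QuantumFieldTheory.Balaban1983to89.B6Geom246MultiLevelTorusL0
import Literature.MathematicalPhysics.QuantumFieldTheory.Balaban1983to89.B6GlobalChartV1L0
import Literature.MathematicalPhysics.QuantumFieldTheory.Balaban1983to89.B6MultiLevelTorusOperatorL0
import Literature.MathematicalPhysics.QuantumFieldTheory.Balaban1983to89.B6Partition118KLevelTorusBindersL0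
import Literature.MathematicalPhysics.QuantumFieldTheory.Balaban1983to89.B6Partition118KLevelTorusCentralL0
import Literature.MathematicalPhysics.QuantumFieldTheory.Balaban1983to89.B6Prop26KLevelSkeletonV1L0
import Literature.MathematicalPhysics.QuantumFieldTheory.Balaban1983to89.B6Prop26KLevelSkeletonV2L0
import Literature.MathematicalPhysics.QuantumFieldTheory.Balaban1983to89.B8Ineq192MultiLevelTorusL0
/-!
# `Balaban1983to89.B6Ineq2134TKFamKLevelExportV1L0` — LEVEL-0 TWIN (programme G-F3′-L0, director-ym LINE №27 / UV3-NODE §24.5; plan `lit-balaban-r03/G-F3L0-PLAN.md`) of `B6Ineq2134TKFamKLevelExportV1`: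
the same declarations, SAME NAMES AND STATEMENTS, for nested families WITH print's region `Λ₀ = T ∖ Ω₁` ADMITTED (structures
`B6MultiLevelBoxOperatorL0.Domains` / `B6MultiLevelTorusOperatorL0.TDomains`: levels `0, …, k`, the level-`0` block a single site, `Q′₀ = id`,
finite weight `a₀` — print p.225 (2.14) «Σ_{j=0}^k … (Q′₀λ)(x) = λ(x), x ∈ Λ₀», p.229 «taking a sequence (2.1) … smallest possible domains B^j(Λ_j),
and considering the operator Δ_a defined by (2.19), (2.20) for this sequence»).  Every `D`-free object is the lineage's, consumed BY NAME; no existing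
module is touched; no fact is minted.  Unit `lit-balaban-p33` (p33 gen 101; programme RIGHT-ENTRY-L0 = the (2.136)₃ right-factor chain at level 0, the input of [B9] Thm 3.3's right entry (3.42)₃ for the bond-sector cube letter G_□(1), cell GAPS G-B9-02; port tooling by r03 gen 36–37); B6 fold owner r03; referee ref-4.  THE TWIN'S DOCUMENTATION FOLLOWS
VERBATIM (its «levels 1 … k» / «Ω₁ = X» sentences describe the twin; here `j` runs from `0` and `Ω₁` may be a proper subset).

# `Balaban1983to89.B6Ineq2134TKFamKLevelExportV1` — T. Bałaban, *Propagators and renormalization transformations for lattice gauge theories. II*,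
# Commun. Math. Phys. **96** (1984) 223–250 [Balaban1984PropagatorsII], (2.134) p. 247 READ FROM THE RIGHT — the sup majorant of the REVERSED pair
# products `h_{□′}G_{□′}K̃_{□,□′}` of the genuine k-level cube family on the V1 torus (p38's `…B6Ineq2134TransposeKLevelTorusL0.h2134T_kFamT_torus` fed with
# every cube input by name, exactly as in p38's `B6Prop26MirrorAssemblyV1`), EXPORTED AS A NAMED PER-PAIR THEOREM with its located smallness — the second
# (2.134) family the `L²` entries (2.140)₄₋₆ consume (through `…B6KFamTransposeKLevelV1.hasMajorant_tr_kFam_of_reversed`; file 14 of the block-`ℓ²` bricks)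

statement-level skeleton of published theorems with citation tags; proofs where landed; nothing here is a claim about the Yang–Mills mass gap

WHAT IS PRINTED (p. 247 [PDF 25]): *"|(K_{□,□′}G_{□′}h_{□′}J)(x)| ≤ O(M⁻¹)e^{−½δ₂d(y,y′)}|J| (2.134) … The operator G can be represented as G = G₀(I − R)⁻¹ =
Σ G₀Rⁿ (2.141) and the series above is convergent in the norms appearing in the inequalities (2.136)–(2.140)."*  Print states (2.91)/(2.134) only in the
left form; the reversed family `K̃` (every product of (2.92)–(2.93) reversed, `…B6Eq291Transpose`) is p38's bookkeeping for the right-factor entries, and for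
the ℓ²-symmetric V1 operators it IS the transpose of the printed family (`…B6KFamTransposeKLevelV1`).

CITATION HEADER (lean-in-tree rule) — WHAT IS REPRODUCED.  Phase-2 file of the `lit-balaban` typed skeleton (HOME `run/shared/lean/pub/lit-balaban/`), seat
**p22 gen 30** (free-target protocol G.5-34(d), TAKING HOME/STATUS 2026-08-24T13:26Z «block-ℓ² walk toward census (2.140)₄₋₆», cc r03/p38; ZERO head weight);
SKELETON rows **B6.Eq2.134** × B6.Eq2.135 × B6.Eq2.92 × B6.Eq2.93 × B6.Prop2.6 (cells only; decls of record untouched).  NOTHING NEW IS PROVED ABOUT THE MEMBERS: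
the proof is p38 gen 31–34's `B6Prop26MirrorAssemblyV1.prop26_2136T_kLevel_assembly_le` (staged `lit-balaban-p38/lean/…p381540.lean`, in flight) VERBATIM
up to the point where it feeds the mirrored chain — p38's `h2134T_kFamT_torus` applied to the RESCALED family with the cube inputs BY NAME (`hGin_cube`,
`hGEin_cube` at the opposite orientation, `hGout_cube`, `hNin_cube`, `hNout_cube`, `hPlin_cube`, `hPlout_cube`, `hdecT_cube`, `inLoc_hB_Ml`, `abs_zC_le`,
`hasMajorant_Dg_V1_TB`, the (1.118) partition binders), `kFamT_smul` back to the true family, the smallness above the threshold `Mbig` — with the family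
bound and the smallness RETURNED instead of consumed:
* §1 p38's three bookkeeping lemmas (`hdecT_smul`, `inLoc_smul`, `inLoc_TB`), re-proved here verbatim (p38's copies live in the pending F12);
* §2 **`h2134T_kFamT_kLevel_le`** — ∃ σ₀ > 0 ∀ 0 < σ ≤ σ₀ ∀ α ≥ 0, N₀ ≥ 1, Nbig, line-1 sizes `s₁, s₂ ≥ 0`, line-3ᵀ data `C_D ≥ 0`, `c_D > 0` ∃ M₁ > 0 ∀
  admissible V1 torus (`M_h = Lᵃ ≥ 8`, `R ≥ 2L²`, `P′ ≥ 5`, `L ≥ 5`, cubes placed, `L·M_h ≥ M₁`), `c′ ≠ 0`, weights `w`, GIVEN the line-1 coefficient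
  sizes/supports and the TRANSPOSED line-3 majorant of `h_□(∂(1−R)∂* − P_□)ζ_□` at rate `2σ`: **∃ θ₁ ≥ 0 with `Nbig²·θ₁·(2·K261 N₀ (d+1) L 1 (ασ)) < 1` and,
  for every pair of cubes, `HasMajorant (geomT D) (blkV1 hN D) (h_{□′}·G_{□′}·K̃_{□,□′}) (θ₁·e^{−σ d_T(y,y′)})`**;
* §3 **`h2134T_kFamT_kLevel_unconditional`** — the line-1 sizes/supports discharged by p38's `…B6CubeCoeffSizesV1` and line 3ᵀ by this seat's
  `…B6Line3CubeTransposeV1L0.line3_cube_transpose` at `σ ≤ min σ₀ (ρ₃/2)`: NO displayed analytic input.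
THEOREMS ONLY (no definition, no `def … : Prop`, no new hypothesis); IMPORTS BY NAME; standard axioms.

HONEST SCOPE / DIVERGENCES.  (1) As p38's F12: `L ≥ 5`, `M_h = L^a ≥ 8`, `R ≥ 2L²`, `P′_μ ≥ 5`, cubes placed; constants on `d, L, b₀, b₁` and the displayed
sizes only; `θ₁ = Θ·V·(L·M_h)⁻¹` is print's `O(M⁻¹)`; print's rate `½δ₂` is our `σ ≤ σ₀`.  (2) The output/input indicators `1_{□̃′}(y)1_{□̃}(y′)` of p38's bound
are dropped (≤ 1) in the exported shape.  (3) This file duplicates ≈ 250 lines of p38's in-flight instantiation (different declarations; when F12 lands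
nothing clashes); credit: p38 gen 31–34.  Integer torus, lattice units; nothing on d = 4 or the continuum; NOT summit progress.  Unit `lit-balaban-p22`
(gen 30), 2026-08-24.
-/

open scoped BigOperators
open Finset

namespace Literature.MathematicalPhysics.QuantumFieldTheory.Balaban1983to89.B6Ineq2134TKFamKLevelExportV1L0

open B6Ineq2134TKFamKLevelExportV1 (hdecT_smul inLoc_smul)

open B4Reflection242 (boxDom)
open B6MultiLevelBoxOperator (N0)
open B6MultiLevelTorusOperatorL0 (TDomains)
open B6Cover236MultiLevelBlocksL0 (cubes)
open B6Geom246MultiLevelBoxL0 (bset blkOf)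
open B6Geom246MultiLevelTorusL0 (geomT bondT)
open B8Ineq192MultiLevelTorusL0 (geomTB geomTB_len geomTB_M geomTB_dist)
open B6RandomWalk (HasMajorant hasMajorant_mono delta3 BlockSupp)
open B6Prop26Gluing (mulOp mulOp_apply LocalMajorant OutLoc InLoc ind ind_nonneg ind_le_one)
open B6Ineq261LevelGap (K261 K261_nonneg)
open B6Ineq2133TwoScaleV1 (onFun)
open B6GlobalChartV1 (PV toBox)
open B6GlobalChartV1L0 (domT blkV1)
open B6SectAOperatorsV1 (dE dsE dcE dcsE QE aE QsE RE BondIdx)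
open B6SectAVectorModelV1 (deltaAE GE)
open B6Partition118KLevelTorusCentral (one_le_of_four_le)
open B6Partition118KLevelTorusCentralL0 (QT QbigT zetaT zetaT_nonneg zetaT_le_one not_mem_QbigT_of_zetaT_ne_one)
open B6Partition118KLevelTorusBinders (sLipT sLipT_nonneg)
open B6Partition118KLevelTorusBindersL0 (abs_hT_sub_le_distT gap_QT)
open B6Prop26KLevelSkeletonV1L0 (hB zB ST pref pref_nonneg abs_hB_le_one blkV1_mem_QT_of_hB_ne_zero)
open B6Prop26KLevelSkeletonV2L0 (SbigT hNov_SbigT_of_QbigT ST_subset_SbigT blkV1_mem_SbigT_of_zB_ne_zero)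
open B6InMajorantTransplant (InMajorant inMajorant_mono inMajorant_smul InMajorant.localMajorant)
open B6InDecayWindowV1 (OutMajorant outMajorant_mono outMajorant_smul)
open B6CubeWindowV1 (Placed GlobalBand band_le one_le_of_eight_le four_le_of_five_le)
open B6CubeWindowV1L0 (Gl Ml Pl)
open B6CubeInDecayV1L0 (hGin_cube hNin_cube hNout_cube hPlin_cube hPlout_cube)
open B6CubeRightLegsV1L0 (hGEin_cube hGout_cube)
open B6Eq292MemberTorusV1L0 (EC cfC c0C NC zC abs_zC_le)
open B6Dg288ChartV1L0 (hasMajorant_Dg_V1_TB)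
open B6Prop26KLevelAssemblyV1 (hasMajorant_smul mulOp_const_mul)
open B6Prop26KLevelAssemblyV1L0 (sq_mul_pref inv_sq_mul_pref_inv lenTB_pos distT_nonneg hasMajorant_TB hasMajorant_T_of_TB inMajorant_TB localMajorant_TB outMajorant_TB)
open B6Eq291Transpose (kFamT kFamT_smul)
open B6Ineq2134TransposeDiag (hasMajorant_left_of_out)
open B6Ineq2134TransposeKLevelTorusL0 (h2134T_kFamT_torus)
open B6OpTransposeV1L0 (hdecT_cube inLoc_hB_Ml)
open B6CubeCoeffSizesV1 (s1C_nonneg s2C_nonneg)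
open B6CubeCoeffSizesV1L0 (abs_cfC_le cfC_supp abs_c0C_le c0C_supp)
open B6Partition118KLevelFineSizes (C1F C1F_nonneg)
open B6Partition118KLevelFineSecond (C2F C2F_nonneg)
open B6Line3CubeTransposeV1L0 (line3_cube_transpose)

noncomputable section

variable {d ℓ : ℕ} {hd : 1 ≤ d + 1} {hL : Odd (ℓ + 1) ∧ 1 < ℓ + 1} {m K : ℕ} {Mh k R : ℕ} {P' : Fin (d + 1) → ℕ}

/-! ## §1  Small algebra (p38's, verbatim) -/

section Algebra

variable {X : Type}

end Algebra

section Units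

variable {D : TDomains d ℓ Mh k P' R} (hN : ∀ μ, N0 ℓ Mh k P' μ = (PV d ℓ m K hd hL).sitesPerDir 0)

/-- an input localisation transfers from `geomT D` to `geomTB D` (same sites, blocks, distance). [cite: Balaban1984PropagatorsII, (2.45)–(2.46) p.231, dictionary] -/
theorem inLoc_TB {T : Module.End ℝ (PBond (PV d ℓ m K hd hL) 0 → ℝ)} {U : Set (B6Geom246MultiLevelTorusL0.geomT D).Site}
    (h : InLoc (g := geomT D) (blkV1 hN D) T U) : InLoc (g := geomTB D) (blkV1 hN D) T U :=
  fun y' μ B hB hy' => h y' μ B ⟨hB.nonneg, hB.bound, hB.off⟩ hy'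

end Units

/-- rate weakening of an exponential kernel. [folklore] -/
private theorem exp_le_exp_of_rate {ρ σ t : ℝ} (h : σ ≤ ρ) (ht : 0 ≤ t) : Real.exp (-(ρ * t)) ≤ Real.exp (-(σ * t)) :=
  Real.exp_le_exp.2 (by nlinarith)

/-! ## §2  The reversed (2.134) family at k levels, exported -/

section Export

set_option maxHeartbeats 1600000 in
open Classical in
/-- **(2.134) READ FROM THE RIGHT FOR THE GENUINE k-LEVEL FAMILY, PER PAIR OF CUBES, WITH ITS LOCATED SMALLNESS — EXPORTED** (p38's mirror assembly up to
its chain step): for the weight band `[b₀, b₁]` there is `σ₀ > 0` such that for every rate `0 < σ ≤ σ₀`, `α ≥ 0`, `N₀ ≥ 1`, overlap number `Nbig` and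
line-1/line-3ᵀ constants there is `M₁ > 0` with: on every admissible V1 torus (`M_h = L^a ≥ 8`, `R ≥ 2L²`, `P′ ≥ 5`, `L ≥ 5`, cubes placed, `L·M_h ≥ M₁`), for
`c′ ≠ 0` and weights `w`, GIVEN the line-1 coefficient sizes/supports and the transposed line-3 majorant at rate `2σ`, there is `θ₁ ≥ 0` (print's `O(M⁻¹)`)
with `Nbig²·θ₁·(2·K261 N₀ (d+1) L 1 (ασ)) < 1` and `|(h_{□′}G_{□′}K̃_{□,□′}J)(x)| ≤ θ₁e^{−σ d_T(y,y′)}|J|` blockwise for EVERY pair `□, □′`.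
[cite: Balaban1984PropagatorsII, (2.134) p.247, (2.92)–(2.94) p.239, (2.133) p.247, (2.88) p.238, Lemma 2.1 p.234] -/
-- LEVEL-0 JOINTS: `(_ : 1 ≤ k)` after `hk` (the L0 `hasMajorant_Dg_V1_TB` needs it; the V1 structure had it built in) — the only statement change of §2;
-- §3 keeps the twin's statement (its `2 ≤ k` supplies it) with the J8 threshold `max … (2L²)` inside the proof (pattern of `B6Prop26GradKLevelV1L0`).
theorem h2134T_kFamT_kLevel_le (d ℓ : ℕ) (hd : 1 ≤ d + 1) (hL : Odd (ℓ + 1) ∧ 1 < ℓ + 1) {b₀ b₁ : ℝ} (hb₀ : 0 < b₀) (hb₁ : b₀ ≤ b₁) :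
    ∃ σ₀ : ℝ, 0 < σ₀ ∧ ∀ (σ : ℝ), 0 < σ → σ ≤ σ₀ → ∀ (α : ℝ), 0 ≤ α → ∀ (N₀ : ℕ), 0 < N₀ → ∀ (Nbig : ℕ) {s₁ s₂ CD cD : ℝ},
      0 ≤ s₁ → 0 ≤ s₂ → 0 ≤ CD → 0 < cD →
    ∃ M₁ : ℝ, 0 < M₁ ∧
    ∀ (m K : ℕ) {Mh k R : ℕ} {P' : Fin (d + 1) → ℕ}
      (hN : ∀ μ, N0 ℓ Mh k P' μ = (PV d ℓ m K hd hL).sitesPerDir 0) (D : B6MultiLevelTorusOperatorL0.TDomains d ℓ Mh k P' R) (hk : k ≤ m + K)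
      (_ : 1 ≤ k) {a : ℕ} (hMha : Mh = (ℓ + 1) ^ a) (hM8 : 8 ≤ Mh) (_ : 2 * (ℓ + 1) ^ 2 ≤ R) (hP5 : ∀ μ, 5 ≤ P' μ) (_ : 4 ≤ ℓ)
      (hpl : ∀ c : ↥(cubes D.toDomains), Placed ℓ k P' c.1)
      (_ : M₁ ≤ ((ℓ : ℝ) + 1) * Mh)
      {cf : ℝ} (_ : cf ≠ 0) (w : BondIdx (B6GlobalChartV1L0.domT hN D hk) → ℝ)
      -- the line-1 coefficients: sizes and supports (p38)
      (_ : ∀ (c : ↥(cubes D.toDomains)) (e : Fin (d + 1) × Bool) (x : PBond (PV d ℓ m K hd hL) 0),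
        |cfC hN hk (one_le_of_eight_le hM8) (four_le_of_five_le hP5) hMha c (band_le (d := d) (ℓ := ℓ) hb₀ hb₁) (hpl c) w cf e x| ≤
          s₁ * cf ^ 2 / ((geomTB D).M * (geomTB D).len (blkV1 hN D x) ^ 2))
      (_ : ∀ (c : ↥(cubes D.toDomains)) (e : Fin (d + 1) × Bool) (x : PBond (PV d ℓ m K hd hL) 0),
        cfC hN hk (one_le_of_eight_le hM8) (four_le_of_five_le hP5) hMha c (band_le (d := d) (ℓ := ℓ) hb₀ hb₁) (hpl c) w cf e x ≠ 0 →
          blkV1 hN D x ∈ ST D (one_le_of_eight_le hM8) (four_le_of_five_le hP5) c)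
      (_ : ∀ (c : ↥(cubes D.toDomains)) (x : PBond (PV d ℓ m K hd hL) 0),
        |c0C hN hk (one_le_of_eight_le hM8) (four_le_of_five_le hP5) hMha c (band_le (d := d) (ℓ := ℓ) hb₀ hb₁) (hpl c) w cf x| ≤
          s₂ * cf ^ 2 / ((geomTB D).M * (geomTB D).len (blkV1 hN D x) ^ 2))
      (_ : ∀ (c : ↥(cubes D.toDomains)) (x : PBond (PV d ℓ m K hd hL) 0),
        c0C hN hk (one_le_of_eight_le hM8) (four_le_of_five_le hP5) hMha c (band_le (d := d) (ℓ := ℓ) hb₀ hb₁) (hpl c) w cf x ≠ 0 →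
          blkV1 hN D x ∈ ST D (one_le_of_eight_le hM8) (four_le_of_five_le hP5) c)
      -- line 3ᵀ (p22's `line3_cube_transpose` shape), rate `2σ`
      (_ : ∀ c : ↥(cubes D.toDomains), HasMajorant (g := geomTB D) (blkV1 hN D)
        (mulOp (hB hN D c) *
          (onFun (dE (P := PV d ℓ m K hd hL) cf ∘ₗ (LinearMap.id - RE (domT hN D hk) cf) ∘ₗ dsE cf) -
            Pl hN hk (one_le_of_eight_le hM8) (four_le_of_five_le hP5) hMha c (band_le (d := d) (ℓ := ℓ) hb₀ hb₁) (hpl c) w cf) *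
          mulOp (zB hN D (one_le_of_eight_le hM8) (four_le_of_five_le hP5) c))
        (fun y y'' => CD * cf ^ 2 * Real.exp (-(cD * (geomTB D).M)) / (geomTB D).len y ^ 2 * Real.exp (-((2 * σ) * (geomTB D).dist y y'')))),
      ∃ θ₁ : ℝ, 0 ≤ θ₁ ∧ (Nbig : ℝ) ^ 2 * θ₁ * (2 * K261 N₀ (d + 1) ((ℓ : ℝ) + 1) 1 (α * σ)) < 1 ∧
        ∀ c c' : ↥(cubes D.toDomains), HasMajorant (g := geomT D) (blkV1 hN D)
          (mulOp (hB hN D c') * Gl hN hk (one_le_of_eight_le hM8) (four_le_of_five_le hP5) hMha c' (band_le (d := d) (ℓ := ℓ) hb₀ hb₁) (hpl c') w cf *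
            kFamT (onFun (dE (P := PV d ℓ m K hd hL) cf ∘ₗ (LinearMap.id - RE (domT hN D hk) cf) ∘ₗ dsE cf))
              (fun c => mulOp (hB hN D c)) (fun c => mulOp (zB hN D (one_le_of_eight_le hM8) (four_le_of_five_le hP5) c))
              (fun c => Ml hN hk (one_le_of_eight_le hM8) (four_le_of_five_le hP5) hMha c (band_le (d := d) (ℓ := ℓ) hb₀ hb₁) (hpl c) w cf)
              (fun c => Pl hN hk (one_le_of_eight_le hM8) (four_le_of_five_le hP5) hMha c (band_le (d := d) (ℓ := ℓ) hb₀ hb₁) (hpl c) w cf) c c')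
          (fun y y' => θ₁ * Real.exp (-(σ * (geomT D).dist y y'))) := by
  -- ### constants of the member / global inputs (p38's `prop26_2136T_kLevel_assembly_le`, verbatim)
  -- ### constants of the member / global inputs (all on `d, L, b₀, b₁` only)
  have ha₀ : (0 : ℝ) < b₀ / ((ℓ + 1 : ℕ) : ℝ) := by positivity
  obtain ⟨ρG, hρG, CG, hCG, hGin⟩ := hGin_cube d ℓ hd hL ha₀ (band_le (d := d) (ℓ := ℓ) hb₀ hb₁)
  obtain ⟨ρE, hρE, CE, hCE, hGEin⟩ := hGEin_cube d ℓ hd hL ha₀ (band_le (d := d) (ℓ := ℓ) hb₀ hb₁)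
  obtain ⟨ρH, hρH, CH, hCH, hGout⟩ := hGout_cube d ℓ hd hL ha₀ (band_le (d := d) (ℓ := ℓ) hb₀ hb₁)
  obtain ⟨ρN, hρN, CN, hCN, hNin⟩ := hNin_cube d ℓ hd hL ha₀ (band_le (d := d) (ℓ := ℓ) hb₀ hb₁)
  obtain ⟨ρN', hρN', CN', hCN', hNout⟩ := hNout_cube d ℓ hd hL ha₀ (band_le (d := d) (ℓ := ℓ) hb₀ hb₁)
  obtain ⟨ρP, hρP, CP, hCP, hPlin⟩ := hPlin_cube d ℓ hd hL ha₀ (band_le (d := d) (ℓ := ℓ) hb₀ hb₁)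
  obtain ⟨ρP', hρP', CP', hCP', hPlout⟩ := hPlout_cube d ℓ hd hL ha₀ (band_le (d := d) (ℓ := ℓ) hb₀ hb₁)
  obtain ⟨M₃, δ₂, C₂, hM₃, hδ₂, hC₂, hDg⟩ := hasMajorant_Dg_V1_TB d ℓ hd hL
  -- the common rate `ρ = 2σ₀` of the (2.134)ᵀ inputs
  obtain ⟨ρ, hρ, hρG', hρE', hρH', hρN1, hρN2, hρP1, hρP2, hρD⟩ :
      ∃ ρ : ℝ, 0 < ρ ∧ ρ ≤ ρG ∧ ρ ≤ ρE ∧ ρ ≤ ρH ∧ ρ ≤ ρN ∧ ρ ≤ ρN' ∧ ρ ≤ ρP ∧ ρ ≤ ρP' ∧ ρ ≤ δ₂ := by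
    refine ⟨min (min ρG ρE) (min (min ρH ρN) (min (min ρN' ρP) (min ρP' δ₂))),
      lt_min (lt_min hρG hρE) (lt_min (lt_min hρH hρN) (lt_min (lt_min hρN' hρP) (lt_min hρP' hδ₂))), ?_, ?_, ?_, ?_, ?_, ?_, ?_, ?_⟩
    · exact (min_le_left _ _).trans (min_le_left _ _)
    · exact (min_le_left _ _).trans (min_le_right _ _)
    · exact (min_le_right _ _).trans ((min_le_left _ _).trans (min_le_left _ _))
    · exact (min_le_right _ _).trans ((min_le_left _ _).trans (min_le_right _ _))
    · exact (min_le_right _ _).trans ((min_le_right _ _).trans ((min_le_left _ _).trans (min_le_left _ _)))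
    · exact (min_le_right _ _).trans ((min_le_right _ _).trans ((min_le_left _ _).trans (min_le_right _ _)))
    · exact (min_le_right _ _).trans ((min_le_right _ _).trans ((min_le_right _ _).trans (min_le_left _ _)))
    · exact (min_le_right _ _).trans ((min_le_right _ _).trans ((min_le_right _ _).trans (min_le_right _ _)))

  refine ⟨ρ / 2, by positivity, ?_⟩
  intro σ hσ0 hσle α hα0 N₀ hN₀ Nbig s₁ s₂ CD cD hs₁ hs₂ hCD hcD
  have h2σ : 2 * σ ≤ ρ := by linarith
  have h2σ0 : 0 < 2 * σ := by positivity
  -- one constant for the four `N`/`P` majorants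
  obtain ⟨CNN, hCNN0, hCN1, hCN2, hCP1, hCP2⟩ : ∃ CNN : ℝ, 0 ≤ CNN ∧ CN ≤ CNN ∧ CN' ≤ CNN ∧ CP ≤ CNN ∧ CP' ≤ CNN :=
    ⟨max (max CN CN') (max CP CP'), le_max_of_le_left (le_max_of_le_left hCN), le_max_of_le_left (le_max_left _ _),
      le_max_of_le_left (le_max_right _ _), le_max_of_le_right (le_max_left _ _), le_max_of_le_right (le_max_right _ _)⟩
  have hK0 : 0 ≤ K261 N₀ (d + 1) ((ℓ : ℝ) + 1) 1 (α * σ) := K261_nonneg (by positivity) zero_le_one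
  -- p38's threshold and constant for the REVERSED kernels of the RESCALED family (all constants `c′`-free)
  obtain ⟨M₁, Θ, hM₁, hΘ, h38⟩ := h2134T_kFamT_torus d ℓ (δG := 2 * σ) h2σ0
  -- the `θ₀`-budget: `θ₀(M) = Θ·V/M`, `V = C_P·C_H/m + U`
  obtain ⟨V, hV⟩ : ∃ V : ℝ, V = ((d : ℝ) + 1) * C₂ * CH / (1 / (2 * ((ℓ : ℝ) + 1) ^ 2)) +
      ((Fintype.card (Fin (d + 1) × Bool) : ℕ) * (s₁ * CE) + s₂ * CG + ((1 : ℕ) + 1) * sLipT d ℓ * ((CNN + 1) * CH * (1 + 1)) + CD * CH / cD) :=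
    ⟨_, rfl⟩
  have hs := sLipT_nonneg d ℓ
  have hVnn : 0 ≤ V := by rw [hV]; positivity
  have hΘV : 0 ≤ Θ * V := mul_nonneg hΘ hVnn
  obtain ⟨Mbig, hMbig⟩ : ∃ Mb : ℝ, Mb = (Nbig : ℝ) * Nbig * (Θ * V) * (2 * K261 N₀ (d + 1) ((ℓ : ℝ) + 1) 1 (α * σ)) + 1 := ⟨_, rfl⟩
  have hprod0 : 0 ≤ (Nbig : ℝ) * Nbig * (Θ * V) * (2 * K261 N₀ (d + 1) ((ℓ : ℝ) + 1) 1 (α * σ)) :=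
    mul_nonneg (mul_nonneg (mul_nonneg (Nat.cast_nonneg _) (Nat.cast_nonneg _)) hΘV) (by linarith)
  have hMbig0 : 0 < Mbig := by rw [hMbig]; linarith
  refine ⟨max (max M₁ M₃) Mbig, lt_max_of_lt_right hMbig0, ?_⟩
  intro m K Mh k R P' hN D hk hk1 a hMha hM8 hR2 hP5 hℓ hpl hM₁' cf hcf w hcfA hcfT hc0A hc0T hD3
  -- ### the torus
  -- ### the torus
  have hMh1 : 1 ≤ Mh := one_le_of_eight_le hM8
  have hP4 : ∀ μ, 4 ≤ P' μ := four_le_of_five_le hP5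
  have hP : ∀ μ, 1 ≤ P' μ := one_le_of_four_le hP4
  have hMh : 2 ≤ Mh := le_trans (by norm_num) hM8
  have hR : 2 * (ℓ + 1) ≤ R := le_trans (by nlinarith : 2 * (ℓ + 1) ≤ 2 * (ℓ + 1) ^ 2) hR2
  have hℓ1 : 1 ≤ ℓ := le_trans (by norm_num) hℓ
  have hLM : M₁ ≤ ((ℓ : ℝ) + 1) * Mh := le_trans ((le_max_left _ _).trans (le_max_left _ _)) hM₁'
  have hLM₃ : M₃ ≤ ((ℓ : ℝ) + 1) * Mh := le_trans ((le_max_right _ _).trans (le_max_left _ _)) hM₁'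
  have hLMbig : Mbig ≤ ((ℓ : ℝ) + 1) * Mh := le_trans (le_max_right _ _) hM₁'
  have hcf2 : cf ^ 2 ≠ 0 := pow_ne_zero 2 hcf
  have hcf2pos : 0 < cf ^ 2 := by positivity
  have habs2 : |cf ^ 2| = cf ^ 2 := abs_of_pos hcf2pos
  have habs2i : |(cf ^ 2)⁻¹| = (cf ^ 2)⁻¹ := abs_of_pos (inv_pos.2 hcf2pos)
  have hMpos : 0 < (geomTB D).M := by rw [geomTB_M]; positivity
  have hMeq : (geomTB D).M = ((ℓ : ℝ) + 1) * Mh := by rw [geomTB_M]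
  have hdnn : ∀ y y' : (geomT D).Site, 0 ≤ (geomT D).dist y y' := distT_nonneg
  -- the global `∂(1 − R)∂*` (p22), rescaled by `c′⁻²`
  have hDg' : HasMajorant (g := geomTB D) (blkV1 hN D)
      ((cf ^ 2)⁻¹ • onFun (dE (P := PV d ℓ m K hd hL) cf ∘ₗ (LinearMap.id - RE (domT hN D hk) cf) ∘ₗ dsE cf))
      (fun y y'' => ((d : ℝ) + 1) * C₂ / (geomTB D).len y ^ 2 * Real.exp (-((2 * σ) * (geomTB D).dist y y''))) := by
    refine hasMajorant_mono _ (hasMajorant_smul _ (hDg m K hN D hk hk1 hMh1 hP4 hR hLM₃ hcf) _) fun y y'' => ?_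
    rw [habs2i]
    have hl := lenTB_pos (D := D) y
    calc (cf ^ 2)⁻¹ * (cf ^ 2 * ((d : ℝ) + 1) * C₂ / (geomTB D).len y ^ 2 * Real.exp (-(δ₂ * (geomTB D).dist y y'')))
        = ((d : ℝ) + 1) * C₂ / (geomTB D).len y ^ 2 * Real.exp (-(δ₂ * (geomTB D).dist y y'')) := by field_simp
      _ ≤ ((d : ℝ) + 1) * C₂ / (geomTB D).len y ^ 2 * Real.exp (-((2 * σ) * (geomTB D).dist y y'')) :=
          mul_le_mul_of_nonneg_left (exp_le_exp_of_rate (h2σ.trans hρD) (hdnn y y'')) (by positivity)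
  -- ### p38's mirrored (2.134) for the rescaled family
  have H := h38 D hMh1 hP hR hLM (blkV1 hN D) (CP := ((d : ℝ) + 1) * C₂) (by positivity) hDg'
    (CG := CG) (CH := CH) (C₁ := CE) (CN := CNN) (CD := CD) (cD := cD) (s := sLipT d ℓ) (s₁ := s₁) (s₂ := s₂) (r₀ := 1)
    (m := 1 / (2 * ((ℓ : ℝ) + 1) ^ 2)) hCG hCH hCE hCNN0 hCD hcD hs hs₁ hs₂ zero_le_one (by positivity)
    (Fintype.card (Fin (d + 1) × Bool)) 1 (Finset.univ : Finset ↥(cubes D.toDomains))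
    (G := fun c => cf ^ 2 • Gl hN hk hMh1 hP4 hMha c (band_le (d := d) (ℓ := ℓ) hb₀ hb₁) (hpl c) w cf)
    (Ml := fun c => (cf ^ 2)⁻¹ • Ml hN hk hMh1 hP4 hMha c (band_le (d := d) (ℓ := ℓ) hb₀ hb₁) (hpl c) w cf)
    (Pl := fun c => (cf ^ 2)⁻¹ • Pl hN hk hMh1 hP4 hMha c (band_le (d := d) (ℓ := ℓ) hb₀ hb₁) (hpl c) w cf)
    (h := fun c => hB hN D c) (ζ := fun c => zB hN D hMh1 hP4 c)
    (c₀ := fun c x => (cf ^ 2)⁻¹ * c0C hN hk hMh1 hP4 hMha c (band_le (d := d) (ℓ := ℓ) hb₀ hb₁) (hpl c) w cf x)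
    (T := fun c => ST D hMh1 hP4 c) (S := fun c => ST D hMh1 hP4 c) (U := fun c => SbigT D hMh1 hP4 c) (Score := fun c => SbigT D hMh1 hP4 c)
    (DE := fun _ => (Finset.univ : Finset (Fin (d + 1) × Bool)))
    (E := fun c e => EC hN hk hMh1 hP4 hMha c (band_le (d := d) (ℓ := ℓ) hb₀ hb₁) (hpl c) w cf (e.1, !e.2))
    (cf := fun c e x => (cf ^ 2)⁻¹ * cfC hN hk hMh1 hP4 hMha c (band_le (d := d) (ℓ := ℓ) hb₀ hb₁) (hpl c) w cf e x)
    (DK := fun _ => ({()} : Finset Unit))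
    (N := fun c _ => (cf ^ 2)⁻¹ • NC hN hk hMh1 hP4 hMha c (band_le (d := d) (ℓ := ℓ) hb₀ hb₁) (hpl c) w cf)
    (z := fun c _ => zC hN hk hMh1 hP4 hMha c (band_le (d := d) (ℓ := ℓ) hb₀ hb₁) (hpl c) w cf)
    -- hnE, hnK
    (fun c _ => le_of_eq Finset.card_univ) (fun c _ => by simp)
    -- hdecT (p38's `hdecT_cube`, rescaled)
    (fun c _ => hdecT_smul Finset.univ ({()} : Finset Unit)
      (N := fun _ => NC hN hk hMh1 hP4 hMha c (band_le (d := d) (ℓ := ℓ) hb₀ hb₁) (hpl c) w cf)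
      (z := fun _ => zC hN hk hMh1 hP4 hMha c (band_le (d := d) (ℓ := ℓ) hb₀ hb₁) (hpl c) w cf)
      (hdecT_cube hN hk hMh1 hP4 hMha c (band_le (d := d) (ℓ := ℓ) hb₀ hb₁) ha₀ hM8 hR2 (hpl c) w cf) _)
    -- hG (r03's `hGin_cube`)
    (fun c _ => by
      refine localMajorant_TB hN (inMajorant_mono (g := geomT D) _
        (inMajorant_smul _ (hGin m K hN D hk hMh1 hP4 hMha hMh hR2 hℓ c (hpl c) w cf) (cf ^ 2))
        (K' := fun (y y' : (geomT D).Site) => CG * (geomTB D).len y ^ 2 * Real.exp (-((2 * σ) * (geomT D).dist y y'))) fun y y' _ => ?_).localMajorant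
      rw [habs2, ← sq_mul_pref cf hcf y]
      have := pref_nonneg cf y
      calc cf ^ 2 * (CG * pref cf y * Real.exp (-(ρG * (geomT D).dist y y')))
          = CG * (cf ^ 2 * pref cf y) * Real.exp (-(ρG * (geomT D).dist y y')) := by ring
        _ ≤ CG * (cf ^ 2 * pref cf y) * Real.exp (-((2 * σ) * (geomT D).dist y y')) :=
            mul_le_mul_of_nonneg_left (exp_le_exp_of_rate (h2σ.trans hρG') (hdnn y y')) (by positivity))
    -- hGE (p22's `hGEin_cube`, the right legs)
    (fun c _ e _ => by
      have hx := inMajorant_mono (g := geomT D) _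
        (inMajorant_smul _ (hGEin m K hN D hk hMh1 hP4 hMha hMh hR2 hℓ c (hpl c) w cf (e.1, !e.2)) (cf ^ 2))
        (K' := fun (y y' : (geomT D).Site) => CE * (geomTB D).len y ^ 2 * Real.exp (-((2 * σ) * (geomT D).dist y y'))) fun y y' _ => by
          rw [habs2, ← sq_mul_pref cf hcf y]
          have := pref_nonneg cf y
          calc cf ^ 2 * (CE * pref cf y * Real.exp (-(ρE * (geomT D).dist y y')))
              = CE * (cf ^ 2 * pref cf y) * Real.exp (-(ρE * (geomT D).dist y y')) := by ring
            _ ≤ CE * (cf ^ 2 * pref cf y) * Real.exp (-((2 * σ) * (geomT D).dist y y')) :=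
                mul_le_mul_of_nonneg_left (exp_le_exp_of_rate (h2σ.trans hρE') (hdnn y y')) (by positivity)
      rw [← smul_mul_assoc] at hx
      exact localMajorant_TB hN hx.localMajorant)
    -- hHG (p22's `hGout_cube`: `h_□G_□` as a global operator)
    (fun c _ => by
      have hx : HasMajorant (g := geomT D) (blkV1 hN D) (mulOp (hB hN D c) * Gl hN hk hMh1 hP4 hMha c (band_le (d := d) (ℓ := ℓ) hb₀ hb₁) (hpl c) w cf)
          (fun y y' => CH * pref cf y * Real.exp (-(ρH * (geomT D).dist y y'))) :=
        hasMajorant_left_of_out (blkV1 hN D) (fun y y' => by have := pref_nonneg cf y; positivity)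
          (fun y' μ B hμ x hx => hGout m K hN D hk hMh1 hP4 hMha hMh hR2 hℓ c (hpl c) w cf y' μ B hμ x hx)
          (fun x hx => blkV1_mem_QT_of_hB_ne_zero hN D hMh hR hP4 c hx)
          (fun x => abs_hB_le_one hN D hMh1 hP c x)
      have hx2 := hasMajorant_smul _ hx (cf ^ 2)
      rw [← mul_smul_comm] at hx2
      refine hasMajorant_TB hN (hasMajorant_mono (g := geomT D) _ hx2 fun y y' => ?_)
      rw [habs2, ← sq_mul_pref cf hcf y]
      have := pref_nonneg cf y
      calc cf ^ 2 * (CH * pref cf y * Real.exp (-(ρH * (geomT D).dist y y')))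
          = CH * (cf ^ 2 * pref cf y) * Real.exp (-(ρH * (geomT D).dist y y')) := by ring
        _ ≤ CH * (cf ^ 2 * pref cf y) * Real.exp (-((2 * σ) * (geomT D).dist y y')) :=
            mul_le_mul_of_nonneg_left (exp_le_exp_of_rate (h2σ.trans hρH') (hdnn y y')) (by positivity))
    -- hcf, hcfS
    (fun c _ e _ x => by
      have hl := lenTB_pos (D := D) (blkV1 hN D x)
      rw [abs_mul, habs2i]
      calc (cf ^ 2)⁻¹ * |cfC hN hk hMh1 hP4 hMha c (band_le (d := d) (ℓ := ℓ) hb₀ hb₁) (hpl c) w cf e x|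
          ≤ (cf ^ 2)⁻¹ * (s₁ * cf ^ 2 / ((geomTB D).M * (geomTB D).len (blkV1 hN D x) ^ 2)) :=
            mul_le_mul_of_nonneg_left (hcfA c e x) (by positivity)
        _ = s₁ / ((geomTB D).M * (geomTB D).len (blkV1 hN D x) ^ 2) := by field_simp)
    (fun c _ e _ x hx => hcfT c e x (right_ne_zero_of_mul hx))
    -- hc₀, hc₀S
    (fun c _ x => by
      have hl := lenTB_pos (D := D) (blkV1 hN D x)
      rw [abs_mul, habs2i]
      calc (cf ^ 2)⁻¹ * |c0C hN hk hMh1 hP4 hMha c (band_le (d := d) (ℓ := ℓ) hb₀ hb₁) (hpl c) w cf x|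
          ≤ (cf ^ 2)⁻¹ * (s₂ * cf ^ 2 / ((geomTB D).M * (geomTB D).len (blkV1 hN D x) ^ 2)) :=
            mul_le_mul_of_nonneg_left (hc0A c x) (by positivity)
        _ = s₂ / ((geomTB D).M * (geomTB D).len (blkV1 hN D x) ^ 2) := by field_simp)
    (fun c _ x hx => hc0T c x (right_ne_zero_of_mul hx))
    -- hh1, hhS, hST, hSU, hLip
    (fun c _ x => abs_hB_le_one hN D hMh1 hP c x)
    (fun c _ x hx => blkV1_mem_QT_of_hB_ne_zero hN D hMh hR hP4 c hx)
    (fun c _ => fun _ hy => hy)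
    (fun c _ => ST_subset_SbigT D hMh1 hP4 c)
    (fun c _ x x' => abs_hT_sub_le_distT hℓ1 hMh hR hP5 c (toBox hN x.src) (toBox hN x'.src))
    -- hNin, hNout
    (fun c _ k _ => by
      refine inMajorant_TB hN (inMajorant_mono (g := geomT D) _ (inMajorant_smul _ (hNin m K hN D hk hMh1 hP4 hMha hMh hR2 hℓ c (hpl c) w cf) ((cf ^ 2)⁻¹))
        (K' := fun (y y'' : (geomT D).Site) => CNN / (geomTB D).len y ^ 2 * Real.exp (-((2 * σ) * (geomT D).dist y y''))) fun y y'' _ => ?_)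
      rw [habs2i]
      have hl := lenTB_pos (D := D) y
      calc (cf ^ 2)⁻¹ * (CN * (pref cf y)⁻¹ * Real.exp (-(ρN * (geomT D).dist y y'')))
          = CN * ((cf ^ 2)⁻¹ * (pref cf y)⁻¹) * Real.exp (-(ρN * (geomT D).dist y y'')) := by ring
        _ = CN / (geomTB D).len y ^ 2 * Real.exp (-(ρN * (geomT D).dist y y'')) := by rw [inv_sq_mul_pref_inv cf hcf y]; ring
        _ ≤ CNN / (geomTB D).len y ^ 2 * Real.exp (-((2 * σ) * (geomT D).dist y y'')) :=
            mul_le_mul (div_le_div_of_nonneg_right hCN1 (by positivity)) (exp_le_exp_of_rate (h2σ.trans hρN1) (hdnn y y''))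
              (Real.exp_nonneg _) (by positivity))
    (fun c _ k _ => by
      have hx := outMajorant_mono (g := geomT D) _ (outMajorant_smul _ (hNout m K hN D hk hMh1 hP4 hMha hMh hR2 hℓ c (hpl c) w cf) ((cf ^ 2)⁻¹))
        (K' := fun (y y'' : (geomT D).Site) => CNN / (geomTB D).len y ^ 2 * Real.exp (-((2 * σ) * (geomT D).dist y y''))) fun y _ y'' => by
          rw [habs2i]
          have hl := lenTB_pos (D := D) y
          calc (cf ^ 2)⁻¹ * (CN' * (pref cf y)⁻¹ * Real.exp (-(ρN' * (geomT D).dist y y'')))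
              = CN' * ((cf ^ 2)⁻¹ * (pref cf y)⁻¹) * Real.exp (-(ρN' * (geomT D).dist y y'')) := by ring
            _ = CN' / (geomTB D).len y ^ 2 * Real.exp (-(ρN' * (geomT D).dist y y'')) := by rw [inv_sq_mul_pref_inv cf hcf y]; ring
            _ ≤ CNN / (geomTB D).len y ^ 2 * Real.exp (-((2 * σ) * (geomT D).dist y y'')) :=
                mul_le_mul (div_le_div_of_nonneg_right hCN2 (by positivity)) (exp_le_exp_of_rate (h2σ.trans hρN2) (hdnn y y''))
                  (Real.exp_nonneg _) (by positivity)
      exact outMajorant_TB hN hx)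
    -- hz
    (fun c _ k _ x => abs_zC_le hN hk hMh1 hP4 hMha c (band_le (d := d) (ℓ := ℓ) hb₀ hb₁) (hpl c) w cf x)
    -- hMin (p38's `inLoc_hB_Ml`, rescaled)
    (fun c _ => by
      have hx := inLoc_smul (g := geomT D) (blkV1 hN D)
        (inLoc_hB_Ml hN hk hMh1 hP4 hMha c (band_le (d := d) (ℓ := ℓ) hb₀ hb₁) ha₀ hM8 hR2 hP5 (hpl c) w cf (hcfT c) (hc0T c)) ((cf ^ 2)⁻¹)
      rw [← mul_smul_comm] at hx
      exact inLoc_TB hN hx)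
    -- hPlin, hPlout
    (fun c _ => by
      refine inMajorant_TB hN (inMajorant_mono (g := geomT D) _ (inMajorant_smul _ (hPlin m K hN D hk hMh1 hP4 hMha hMh hR2 hℓ c (hpl c) w cf) ((cf ^ 2)⁻¹))
        (K' := fun (y y'' : (geomT D).Site) => CNN / (geomTB D).len y ^ 2 * Real.exp (-((2 * σ) * (geomT D).dist y y''))) fun y y'' _ => ?_)
      rw [habs2i]
      have hl := lenTB_pos (D := D) y
      calc (cf ^ 2)⁻¹ * (CP * (pref cf y)⁻¹ * Real.exp (-(ρP * (geomT D).dist y y'')))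
          = CP * ((cf ^ 2)⁻¹ * (pref cf y)⁻¹) * Real.exp (-(ρP * (geomT D).dist y y'')) := by ring
        _ = CP / (geomTB D).len y ^ 2 * Real.exp (-(ρP * (geomT D).dist y y'')) := by rw [inv_sq_mul_pref_inv cf hcf y]; ring
        _ ≤ CNN / (geomTB D).len y ^ 2 * Real.exp (-((2 * σ) * (geomT D).dist y y'')) :=
            mul_le_mul (div_le_div_of_nonneg_right hCP1 (by positivity)) (exp_le_exp_of_rate (h2σ.trans hρP1) (hdnn y y''))
              (Real.exp_nonneg _) (by positivity))
    (fun c _ => by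
      have hx := outMajorant_mono (g := geomT D) _ (outMajorant_smul _ (hPlout m K hN D hk hMh1 hP4 hMha hMh hR2 hℓ c (hpl c) w cf) ((cf ^ 2)⁻¹))
        (K' := fun (y y'' : (geomT D).Site) => CNN / (geomTB D).len y ^ 2 * Real.exp (-((2 * σ) * (geomT D).dist y y''))) fun y _ y'' => by
          rw [habs2i]
          have hl := lenTB_pos (D := D) y
          calc (cf ^ 2)⁻¹ * (CP' * (pref cf y)⁻¹ * Real.exp (-(ρP' * (geomT D).dist y y'')))
              = CP' * ((cf ^ 2)⁻¹ * (pref cf y)⁻¹) * Real.exp (-(ρP' * (geomT D).dist y y'')) := by ring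
            _ = CP' / (geomTB D).len y ^ 2 * Real.exp (-(ρP' * (geomT D).dist y y'')) := by rw [inv_sq_mul_pref_inv cf hcf y]; ring
            _ ≤ CNN / (geomTB D).len y ^ 2 * Real.exp (-((2 * σ) * (geomT D).dist y y'')) :=
                mul_le_mul (div_le_div_of_nonneg_right hCP2 (by positivity)) (exp_le_exp_of_rate (h2σ.trans hρP2) (hdnn y y''))
                  (Real.exp_nonneg _) (by positivity)
      exact outMajorant_TB hN hx)
    -- hζ0, hζ1, hζU, hζS
    (fun c _ x => zetaT_nonneg hMh1 hP4 c (toBox hN x.src)) (fun c _ x => zetaT_le_one hMh1 hP4 c (toBox hN x.src))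
    (fun c _ x hx => blkV1_mem_SbigT_of_zB_ne_zero hN D hMh1 hP4 c hx)
    (fun c _ x hx => not_mem_QbigT_of_zetaT_ne_one hMh1 hP4 c hx)
    -- hD3ᵀ (rescaled)
    (fun c _ => by
      have hx := hasMajorant_smul _ (hD3 c) ((cf ^ 2)⁻¹)
      have eop : (cf ^ 2)⁻¹ • (mulOp (hB hN D c) *
            (onFun (dE (P := PV d ℓ m K hd hL) cf ∘ₗ (LinearMap.id - RE (domT hN D hk) cf) ∘ₗ dsE cf) -
              Pl hN hk hMh1 hP4 hMha c (band_le (d := d) (ℓ := ℓ) hb₀ hb₁) (hpl c) w cf) * mulOp (zB hN D hMh1 hP4 c)) =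
          mulOp (hB hN D c) *
            ((cf ^ 2)⁻¹ • onFun (dE (P := PV d ℓ m K hd hL) cf ∘ₗ (LinearMap.id - RE (domT hN D hk) cf) ∘ₗ dsE cf) -
              (cf ^ 2)⁻¹ • Pl hN hk hMh1 hP4 hMha c (band_le (d := d) (ℓ := ℓ) hb₀ hb₁) (hpl c) w cf) * mulOp (zB hN D hMh1 hP4 c) := by
        simp only [smul_sub, mul_sub, sub_mul, mul_smul_comm, smul_mul_assoc]
      rw [eop] at hx
      refine hasMajorant_mono _ hx fun y y'' => le_of_eq ?_
      rw [habs2i]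
      have hl := lenTB_pos (D := D) y
      field_simp)
    -- hgap (read from the input side: the torus distance is symmetric)
    (fun c _ y'' b hy'' hb => by
      have hg := gap_QT hℓ1 hMh hR hP5 c hb hy''
      rw [SimpleGraph.dist_comm] at hg
      exact hg)
  -- ### back to the TRUE family: `h·(c′²G_□)·(c′⁻²K̃) = h·G_□·K̃`
  have h2134T : ∀ c c' : ↥(cubes D.toDomains), HasMajorant (g := geomT D) (blkV1 hN D)
      (mulOp (hB hN D c') * Gl hN hk hMh1 hP4 hMha c' (band_le (d := d) (ℓ := ℓ) hb₀ hb₁) (hpl c') w cf *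
        kFamT (onFun (dE (P := PV d ℓ m K hd hL) cf ∘ₗ (LinearMap.id - RE (domT hN D hk) cf) ∘ₗ dsE cf))
          (fun c => mulOp (hB hN D c)) (fun c => mulOp (zB hN D hMh1 hP4 c))
          (fun c => Ml hN hk hMh1 hP4 hMha c (band_le (d := d) (ℓ := ℓ) hb₀ hb₁) (hpl c) w cf)
          (fun c => Pl hN hk hMh1 hP4 hMha c (band_le (d := d) (ℓ := ℓ) hb₀ hb₁) (hpl c) w cf) c c')
      (fun y y' => ind (SbigT D hMh1 hP4 c') y * ind (SbigT D hMh1 hP4 c) y' * (Θ * V * ((geomTB D).M)⁻¹ * Real.exp (-(σ * (geomT D).dist y y')))) := by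
    intro c c'
    have h := H c (Finset.mem_univ _) c' (Finset.mem_univ _)
    have eK : mulOp (hB hN D c') * (cf ^ 2 • Gl hN hk hMh1 hP4 hMha c' (band_le (d := d) (ℓ := ℓ) hb₀ hb₁) (hpl c') w cf) *
        kFamT ((cf ^ 2)⁻¹ • onFun (dE (P := PV d ℓ m K hd hL) cf ∘ₗ (LinearMap.id - RE (domT hN D hk) cf) ∘ₗ dsE cf))
          (fun c => mulOp (hB hN D c)) (fun c => mulOp (zB hN D hMh1 hP4 c))
          (fun c => (cf ^ 2)⁻¹ • Ml hN hk hMh1 hP4 hMha c (band_le (d := d) (ℓ := ℓ) hb₀ hb₁) (hpl c) w cf)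
          (fun c => (cf ^ 2)⁻¹ • Pl hN hk hMh1 hP4 hMha c (band_le (d := d) (ℓ := ℓ) hb₀ hb₁) (hpl c) w cf) c c' =
        mulOp (hB hN D c') * Gl hN hk hMh1 hP4 hMha c' (band_le (d := d) (ℓ := ℓ) hb₀ hb₁) (hpl c') w cf *
        kFamT (onFun (dE (P := PV d ℓ m K hd hL) cf ∘ₗ (LinearMap.id - RE (domT hN D hk) cf) ∘ₗ dsE cf))
          (fun c => mulOp (hB hN D c)) (fun c => mulOp (zB hN D hMh1 hP4 c))
          (fun c => Ml hN hk hMh1 hP4 hMha c (band_le (d := d) (ℓ := ℓ) hb₀ hb₁) (hpl c) w cf)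
          (fun c => Pl hN hk hMh1 hP4 hMha c (band_le (d := d) (ℓ := ℓ) hb₀ hb₁) (hpl c) w cf) c c' := by
      rw [kFamT_smul]
      simp only [mul_smul_comm, smul_mul_assoc, smul_smul]
      rw [inv_mul_cancel₀ hcf2, one_smul]
    rw [eK] at h
    refine hasMajorant_T_of_TB hN (hasMajorant_mono (g := geomTB D) (blkV1 hN D) h fun y y' => le_of_eq ?_)
    rw [hV, geomTB_dist, show (2 * σ) / 2 = σ by ring]
    rfl
  -- ### the smallness of `θ₀ = Θ·V/M` above `Mbig`
  -- ### the smallness of `θ₀ = Θ·V/M` above `Mbig`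
  have hMinv0 : 0 ≤ ((geomTB D).M)⁻¹ := inv_nonneg.2 hMpos.le
  have hθ₀nn : 0 ≤ Θ * V * ((geomTB D).M)⁻¹ := mul_nonneg hΘV hMinv0
  have hsmall2 : ((Nbig : ℝ) * Nbig * (Θ * V * ((geomTB D).M)⁻¹)) * (2 * K261 N₀ (d + 1) ((ℓ : ℝ) + 1) 1 (α * σ)) < 1 := by
    have hMb : (Nbig : ℝ) * Nbig * (Θ * V) * (2 * K261 N₀ (d + 1) ((ℓ : ℝ) + 1) 1 (α * σ)) + 1 ≤ (geomTB D).M := by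
      rw [hMeq, ← hMbig]; exact hLMbig
    have e : ((Nbig : ℝ) * Nbig * (Θ * V * ((geomTB D).M)⁻¹)) * (2 * K261 N₀ (d + 1) ((ℓ : ℝ) + 1) 1 (α * σ)) =
        ((Nbig : ℝ) * Nbig * (Θ * V) * (2 * K261 N₀ (d + 1) ((ℓ : ℝ) + 1) 1 (α * σ))) / (geomTB D).M := by
      rw [div_eq_mul_inv]; ring
    rw [e, div_lt_one hMpos]
    linarith

  -- ### out: `θ₁ = Θ·V/M`, its smallness, and the family bound with the indicators dropped
  refine ⟨Θ * V * ((geomTB D).M)⁻¹, hθ₀nn, by rw [sq]; exact hsmall2, fun c c' => hasMajorant_mono _ (h2134T c c') fun y y' => ?_⟩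
  have h1 := ind_le_one (SbigT D hMh1 hP4 c') y
  have h2 := ind_le_one (SbigT D hMh1 hP4 c) y'
  have h3 := ind_nonneg (SbigT D hMh1 hP4 c') y
  have h4 := ind_nonneg (SbigT D hMh1 hP4 c) y'
  have h5 : 0 ≤ Θ * V * ((geomTB D).M)⁻¹ * Real.exp (-(σ * (geomT D).dist y y')) := mul_nonneg hθ₀nn (Real.exp_nonneg _)
  calc ind (SbigT D hMh1 hP4 c') y * ind (SbigT D hMh1 hP4 c) y' * (Θ * V * ((geomTB D).M)⁻¹ * Real.exp (-(σ * (geomT D).dist y y')))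
      ≤ 1 * 1 * (Θ * V * ((geomTB D).M)⁻¹ * Real.exp (-(σ * (geomT D).dist y y'))) :=
        mul_le_mul_of_nonneg_right (mul_le_mul h1 h2 h4 zero_le_one) h5
    _ = _ := by ring

end Export

/-- `max M (2L²) ≤ L·M_h` gives the level-0 joint `2L ≤ M_h` (J8 absorbed into the threshold; copy of the private helper of `B6Prop26GradKLevelV1L0`).
[cite: Balaban1984PropagatorsII, (2.2) p.224, bookkeeping] -/
private theorem hMhL_of_max_le {ℓ Mh : ℕ} {M : ℝ} (h : max M (2 * ((ℓ : ℝ) + 1) ^ 2) ≤ ((ℓ : ℝ) + 1) * Mh) : 2 * (ℓ + 1) ≤ Mh := by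
  have h2 : 2 * ((ℓ : ℝ) + 1) ^ 2 ≤ ((ℓ : ℝ) + 1) * Mh := (le_max_right _ _).trans h
  have hL : (0 : ℝ) < (ℓ : ℝ) + 1 := by positivity
  have h3 : ((2 * (ℓ + 1) : ℕ) : ℝ) ≤ (Mh : ℝ) := by push_cast; nlinarith
  exact_mod_cast h3

/-! ## §3  Line 1 and line 3ᵀ discharged: no displayed analytic input -/

section Unconditional

open Classical in
/-- **THE REVERSED (2.134) FAMILY AT k LEVELS FOR THE GENUINE CUBES — NO DISPLAYED ANALYTIC HYPOTHESIS** (`h2134T_kFamT_kLevel_le` with the line-1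
sizes/supports fed by p38's `abs_cfC_le`/`cfC_supp`/`abs_c0C_le`/`c0C_supp` and line 3ᵀ by `…B6Line3CubeTransposeV1L0.line3_cube_transpose` at
`σ ≤ min σ₀ (ρ₃/2)`): for the weight band there is `σ₁ > 0` such that for all `0 < σ ≤ σ₁`, `α ≥ 0`, `N₀ ≥ 1`, `Nbig` there is `M₂ > 0` with: on every admissible V1
torus with `k ≥ 2`, `M_h = Lᵃ ≥ 8`, `M₂ ≤ L·M_h`, `R ≥ 2L²`, `P′ ≥ 5`, `L ≥ 5`, cubes placed, for `c′ ≠ 0` and all weights, ∃ θ₁ ≥ 0 with `Nbig²θ₁·(2K261) < 1` and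
the majorant `θ₁e^{−σd_T}` of every reversed product `h_{□′}G_{□′}K̃_{□,□′}`. [cite: Balaban1984PropagatorsII, (2.134) p.247, (2.92) p.239, Lemma 2.1 p.234] -/
theorem h2134T_kFamT_kLevel_unconditional (d ℓ : ℕ) (hd : 1 ≤ d + 1) (hL : Odd (ℓ + 1) ∧ 1 < ℓ + 1) {b₀ b₁ : ℝ} (hb₀ : 0 < b₀) (hb₁ : b₀ ≤ b₁) :
    ∃ σ₁ : ℝ, 0 < σ₁ ∧ ∀ (σ : ℝ), 0 < σ → σ ≤ σ₁ → ∀ (α : ℝ), 0 ≤ α → ∀ (N₀ : ℕ), 0 < N₀ → ∀ (Nbig : ℕ),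
    ∃ M₂ : ℝ, 0 < M₂ ∧
    ∀ (m K : ℕ) {Mh k R : ℕ} {P' : Fin (d + 1) → ℕ}
      (hN : ∀ μ, N0 ℓ Mh k P' μ = (PV d ℓ m K hd hL).sitesPerDir 0) (D : B6MultiLevelTorusOperatorL0.TDomains d ℓ Mh k P' R) (hk : k ≤ m + K) (_ : 2 ≤ k)
      {a : ℕ} (hMha : Mh = (ℓ + 1) ^ a) (hM8 : 8 ≤ Mh) (_ : 2 * (ℓ + 1) ^ 2 ≤ R) (hP5 : ∀ μ, 5 ≤ P' μ) (_ : 4 ≤ ℓ)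
      (hpl : ∀ c : ↥(cubes D.toDomains), Placed ℓ k P' c.1)
      (_ : M₂ ≤ ((ℓ : ℝ) + 1) * Mh)
      {cf : ℝ} (_ : cf ≠ 0) (w : BondIdx (B6GlobalChartV1L0.domT hN D hk) → ℝ),
      ∃ θ₁ : ℝ, 0 ≤ θ₁ ∧ (Nbig : ℝ) ^ 2 * θ₁ * (2 * K261 N₀ (d + 1) ((ℓ : ℝ) + 1) 1 (α * σ)) < 1 ∧
        ∀ c c' : ↥(cubes D.toDomains), HasMajorant (g := geomT D) (blkV1 hN D)
          (mulOp (hB hN D c') * Gl hN hk (one_le_of_eight_le hM8) (four_le_of_five_le hP5) hMha c' (band_le (d := d) (ℓ := ℓ) hb₀ hb₁) (hpl c') w cf *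
            kFamT (onFun (dE (P := PV d ℓ m K hd hL) cf ∘ₗ (LinearMap.id - RE (domT hN D hk) cf) ∘ₗ dsE cf))
              (fun c => mulOp (hB hN D c)) (fun c => mulOp (zB hN D (one_le_of_eight_le hM8) (four_le_of_five_le hP5) c))
              (fun c => Ml hN hk (one_le_of_eight_le hM8) (four_le_of_five_le hP5) hMha c (band_le (d := d) (ℓ := ℓ) hb₀ hb₁) (hpl c) w cf)
              (fun c => Pl hN hk (one_le_of_eight_le hM8) (four_le_of_five_le hP5) hMha c (band_le (d := d) (ℓ := ℓ) hb₀ hb₁) (hpl c) w cf) c c')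
          (fun y y' => θ₁ * Real.exp (-(σ * (geomT D).dist y y'))) := by
  obtain ⟨ρ₃, CD, cD, M₃, hρ₃, hCD, hcD, hcube⟩ := line3_cube_transpose d ℓ hd hL hb₀ hb₁
  obtain ⟨σ₀, hσ₀, h⟩ := h2134T_kFamT_kLevel_le d ℓ hd hL hb₀ hb₁
  refine ⟨min σ₀ (ρ₃ / 2), lt_min hσ₀ (by linarith), fun σ hσ hσ1 α hα0 N₀ hN₀ Nbig => ?_⟩
  obtain ⟨M₁, hM₁, h2⟩ := h σ hσ (hσ1.trans (min_le_left _ _)) α hα0 N₀ hN₀ Nbig (s1C_nonneg d ℓ) (s2C_nonneg d ℓ) hCD hcD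
  refine ⟨max (max M₁ M₃) (2 * ((ℓ : ℝ) + 1) ^ 2), lt_max_of_lt_left (lt_max_of_lt_left hM₁), ?_⟩
  intro m K Mh k R P' hN D hk hk2 a hMha hM8 hR2 hP5 hℓ hpl hM cf hcf w
  have hσρ : 2 * σ ≤ ρ₃ := by linarith [hσ1.trans (min_le_right _ _)]
  have hMhL : 2 * (ℓ + 1) ≤ Mh := hMhL_of_max_le hM
  have hM' : max M₁ M₃ ≤ ((ℓ : ℝ) + 1) * Mh := (le_max_left _ _).trans hM
  refine h2 m K hN D hk (by omega) hMha hM8 hR2 hP5 hℓ hpl ((le_max_left _ _).trans hM') hcf w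
    (fun c e x => abs_cfC_le hN hk (one_le_of_eight_le hM8) (four_le_of_five_le hP5) hMha c (band_le (d := d) (ℓ := ℓ) hb₀ hb₁)
      hM8 hMhL hR2 hP5 (hpl c) w cf e x)
    (fun c e x hx => cfC_supp hN hk (one_le_of_eight_le hM8) (four_le_of_five_le hP5) hMha c (band_le (d := d) (ℓ := ℓ) hb₀ hb₁)
      hM8 hR2 hP5 (hpl c) w cf e x hx)
    (fun c x => abs_c0C_le hN hk (one_le_of_eight_le hM8) (four_le_of_five_le hP5) hMha c (band_le (d := d) (ℓ := ℓ) hb₀ hb₁)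
      hM8 hR2 hP5 (hpl c) w cf x)
    (fun c x hx => c0C_supp hN hk (one_le_of_eight_le hM8) (four_le_of_five_le hP5) hMha c (band_le (d := d) (ℓ := ℓ) hb₀ hb₁)
      hM8 hR2 hP5 (hpl c) w cf x hx)
    fun c => ?_
  refine hasMajorant_mono (g := geomTB D) (blkV1 hN D) (hcube m K hN D hk hk2 hMha hM8 hR2 hP5 hℓ hpl ((le_max_right _ _).trans hM') hcf w c) ?_
  intro y y''
  have hd0 : 0 ≤ (geomTB D).dist y y'' := Nat.cast_nonneg _
  refine mul_le_mul_of_nonneg_left (Real.exp_le_exp.2 (by nlinarith)) ?_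
  have := lenTB_pos (D := D) y
  positivity

end Unconditional

end

end Literature.MathematicalPhysics.QuantumFieldTheory.Balaban1983to89.B6Ineq2134TKFamKLevelExportV1L0
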